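import Summits.ResolutionOfSingularities.ResolutionOfSingularities.Theorems.FrobeniusClosingSteerContentFrame
import HarnessLib

/-!
# Crux `Steer` (stmt-ResolutionOfSingularities-16345), chain W4.1 — idea-2's dictionary DICT
# `SimpleIsLogFinal` (F-LU ∧ DICT split of the plan for `stub_nonSwitchingCore`), piece **1: the LOG FRAME**
# of the foliation `ker (d f / (h ∏ z))` at a simple (log-elementary) point — a commuting frame of type
# `μ_p^{s'} × α_p^{n-1-s'}`

OURS (campaign `res-hironaka`, rung L, slot W4.1, chain W4.1; seat res-D-pv-007 AS res-L0-w41-stub-5; replaces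
the role of no printed item; NOT a statement of the manuscript under review [claim: Hironaka2017, status:
under-review]; AI-produced, weaker than expert review). Theses-free, definition-free, PURE COMMUTATIVE ALGEBRA;
sibling of `FrobeniusClosingSteerContentFrame.lean` (res-L0-w41-stub-9's frame for the case WITHOUT boundary).

## Setting

`A` a commutative ring (later: a local domain of characteristic `p`), `y : Fin n → A` a family with DUAL
derivations `Δ` (`Δ i (y j) = δ_ij`) DETERMINING `Der_ℤ(A)` (Kunz `p`-basis shape), a set `J` of BOUNDARY indices
and the LOG FRAME `E m := w m • Δ m` with `w m = y m` for `m ∈ J` and `w m = 1` otherwise (so `E m = y_m ∂_m` resp.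
`∂_m`: a basis of the logarithmic derivations along the boundary `(y_j)_{j ∈ J}`). A SIMPLE (log-elementary) point
of `d f`: `E m f = q * c m` for all `m`, `q ≠ 0`, and some coefficient `c m₀ = 1` (normalised).

## Results (namespace `…SwitchingDichotomy.LogFrame`)

* `exists_isUnit_logCoeff` — from «`q` divides `θ f` for every logarithmic `θ`» and «some logarithmic `θ₀`
  has `θ₀ f = q * unit`»: coefficients `c` with `E m f = q * c m` and a UNIT coefficient.
* the frame `ε m := E m - (c m * w m₀) • Δ m₀ = E m - c m • E m₀` (`m ≠ m₀`): kills `f` (`frame_apply_f`), is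
  diagonal-dual on `y m'`, `m' ≠ m₀` (`frame_apply_y`), a derivation killing `f` and the `y m'`, `m' ≠ m₀`, is ZERO
  (`eq_zero_of_apply_eq_zero`), hence the frame COMMUTES (`frame_comm`), the TRANSVERSAL members (`m ∉ J`) are
  `p`-NILPOTENT (`iterate_frame_eq_zero`) and the BOUNDARY members (`m ∈ J`) satisfy `ε^[p] = ε`
  (`iterate_frame_eq_self`) — the frame of `{θ ∈ Der(log y_J) | θ f = 0}` integrates to an action of
  `μ_p^{s'} × α_p^{n-1-s'}`; a boundary member maps `𝔪` into `𝔪` as soon as `c m * w m₀ ∈ 𝔪` (`frame_mem_maximalIdeal`).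
* `exists_logFrame` — everything packaged, with the normalisation «`m₀ ∈ J`, or every boundary coefficient is in
  `𝔪`» that makes ALL boundary members preserve `𝔪`.

Sources: H. Matsumura, *Commutative Ring Theory*, §25 (restricted Lie algebra of derivations), §30 (dual
derivations); the frame computation is folklore (first step of the Frobenius theorem; Jacobson's Galois
theory of purely inseparable exponent-one extensions for the `p`-structure). [cite: Matsumura1987, §25, §30]
[folklore]
-/

noncomputable section

-- `Summit.<S>.<S>.…` duplicates the summit name by design (single-problem summit).
set_option linter.dupNamespace false
set_option autoImplicit false

namespace Summit.ResolutionOfSingularities.ResolutionOfSingularities.Theorems.SwitchingDichotomy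

namespace LogFrame

open IsLocalRing
open Literature.RingTheory.Derivation
open ContentFrame (eq_sum_smul apply_eq_sum sum_smul_apply)

variable {A : Type*} [CommRing A] {n : ℕ}

/-! ## The log frame `E m = w m • Δ m` and its coefficients -/

/-- The log frame is logarithmic along the boundary: `y j ∣ (w m • Δ m) (y j)` for `j ∈ J`
(`w j = y j` on the boundary, dual family). [folklore] -/
theorem dvd_logBasis_apply (y : Fin n → A) (Δ : Fin n → Derivation ℤ A A)
    (hdual : ∀ i j, Δ i (y j) = if i = j then 1 else 0) (J : Finset (Fin n)) (w : Fin n → A)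
    (hw : ∀ m, w m = if m ∈ J then y m else 1) (m j : Fin n) (hj : j ∈ J) :
    y j ∣ (w m • Δ m) (y j) := by
  rw [Derivation.smul_apply, hdual, smul_eq_mul]
  by_cases hmj : m = j
  · subst hmj
    rw [if_pos rfl, mul_one, hw, if_pos hj]
  · rw [if_neg hmj, mul_zero]
    exact dvd_zero _

/-- A logarithmic derivation is an `A`-combination of the log frame: if `y j ∣ θ (y j)` for `j ∈ J`
then `θ = ∑ m, s m • (w m • Δ m)` with `s m * w m = θ (y m)`. [cite: Matsumura1987, §30] -/
theorem exists_eq_sum_smul_logBasis (y : Fin n → A) (Δ : Fin n → Derivation ℤ A A)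
    (hdual : ∀ i j, Δ i (y j) = if i = j then 1 else 0)
    (hdet : ∀ δ : Derivation ℤ A A, (∀ i, δ (y i) = 0) → δ = 0) (J : Finset (Fin n)) (w : Fin n → A)
    (hw : ∀ m, w m = if m ∈ J then y m else 1) (θ : Derivation ℤ A A)
    (hθ : ∀ j ∈ J, y j ∣ θ (y j)) :
    ∃ s : Fin n → A, (∀ m, s m * w m = θ (y m)) ∧ θ = ∑ m, s m • (w m • Δ m) := by
  classical
  have hs : ∀ m, ∃ s : A, s * w m = θ (y m) := by
    intro m
    by_cases hm : m ∈ J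
    · obtain ⟨r, hr⟩ := hθ m hm
      exact ⟨r, by rw [hw, if_pos hm, mul_comm, hr]⟩
    · exact ⟨θ (y m), by rw [hw, if_neg hm, mul_one]⟩
  choose s hs using hs
  refine ⟨s, hs, ?_⟩
  conv_lhs => rw [eq_sum_smul y Δ hdual hdet θ]
  exact Finset.sum_congr rfl fun m _ => by rw [← hs m, smul_smul]

/-- **Simple point ⇒ a unit coefficient.** In a local domain: if `q ≠ 0` divides `θ f` for every
logarithmic `θ`, then `(w m • Δ m) f = q * c m` for some coefficients `c`, and if moreover some logarithmic
`θ₀` has `θ₀ f = q * u` with `u` a unit, some `c m₀` is a unit. [folklore] -/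
theorem exists_isUnit_logCoeff [IsDomain A] [IsLocalRing A] (y : Fin n → A) (Δ : Fin n → Derivation ℤ A A)
    (hdual : ∀ i j, Δ i (y j) = if i = j then 1 else 0)
    (hdet : ∀ δ : Derivation ℤ A A, (∀ i, δ (y i) = 0) → δ = 0) (J : Finset (Fin n)) (w : Fin n → A)
    (hw : ∀ m, w m = if m ∈ J then y m else 1) {f q : A} (hq : q ≠ 0)
    (hdiv : ∀ θ : Derivation ℤ A A, (∀ j ∈ J, y j ∣ θ (y j)) → q ∣ θ f)
    (θ₀ : Derivation ℤ A A) (hθ₀ : ∀ j ∈ J, y j ∣ θ₀ (y j)) {u : A} (hu : IsUnit u)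
    (hθ₀f : θ₀ f = q * u) :
    ∃ c : Fin n → A, (∀ m, (w m • Δ m) f = q * c m) ∧ ∃ m₀, IsUnit (c m₀) := by
  classical
  have hc : ∀ m, ∃ c : A, (w m • Δ m) f = q * c := fun m =>
    hdiv _ fun j hj => dvd_logBasis_apply y Δ hdual J w hw m j hj
  choose c hc using hc
  refine ⟨c, hc, ?_⟩
  obtain ⟨s, -, hθs⟩ := exists_eq_sum_smul_logBasis y Δ hdual hdet J w hw θ₀ hθ₀
  have hsum : θ₀ f = q * ∑ m, s m * c m := by
    rw [hθs, sum_smul_apply, Finset.mul_sum]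
    exact Finset.sum_congr rfl fun m _ => by rw [hc m]; ring
  have hu' : u = ∑ m, s m * c m := mul_left_cancel₀ hq (hθ₀f ▸ hsum)
  by_contra hcon
  push Not at hcon
  have hmem : (∑ m, s m * c m) ∈ maximalIdeal A :=
    Ideal.sum_mem _ fun m _ => Ideal.mul_mem_left _ _ ((mem_maximalIdeal _).mpr (hcon m))
  rw [← hu'] at hmem
  exact (mem_maximalIdeal u).mp hmem hu

/-- Normalisation: a unit coefficient may be taken equal to `1` after rescaling `q`. [folklore] -/
theorem exists_logCoeff_eq_one [IsDomain A] {f q : A} (hq : q ≠ 0) {E : Fin n → Derivation ℤ A A}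
    {c : Fin n → A} (hc : ∀ m, E m f = q * c m) {m₀ : Fin n} (hm₀ : IsUnit (c m₀)) :
    ∃ (q' : A) (c' : Fin n → A), q' ≠ 0 ∧ (∀ m, E m f = q' * c' m) ∧ c' m₀ = 1 ∧
      ∀ m, c' m = c m * ↑(hm₀.unit⁻¹) := by
  refine ⟨q * c m₀, fun m => c m * ↑(hm₀.unit⁻¹), mul_ne_zero hq hm₀.ne_zero, fun m => ?_,
    IsUnit.mul_val_inv hm₀, fun m => rfl⟩
  rw [hc m]
  have h1 : c m₀ * ↑(hm₀.unit⁻¹) = 1 := IsUnit.mul_val_inv hm₀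
  linear_combination (-(q * c m)) * h1

/-! ## The frame `ε m = w m • Δ m - (c m * w m₀) • Δ m₀` of `{θ logarithmic | θ f = 0}` -/

section Frame

variable {y : Fin n → A} {Δ : Fin n → Derivation ℤ A A} {w : Fin n → A} {f q : A} {c : Fin n → A}
  {m₀ : Fin n}

/-- The frame kills `f`. [folklore] -/
theorem frame_apply_f (hc : ∀ m, (w m • Δ m) f = q * c m) (hm₀ : c m₀ = 1) (m : Fin n) :
    (w m • Δ m - (c m * w m₀) • Δ m₀) f = 0 := by
  have h0 := hc m₀
  rw [Derivation.smul_apply, smul_eq_mul, hm₀, mul_one] at h0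
  rw [Derivation.sub_apply, hc m, Derivation.smul_apply, smul_eq_mul, mul_assoc, h0]
  ring

/-- The frame on `y m'`, `m' ≠ m₀`: diagonal with entries `w m`. [folklore] -/
theorem frame_apply_y (hdual : ∀ i j, Δ i (y j) = if i = j then 1 else 0) (m : Fin n) {m' : Fin n}
    (hm' : m' ≠ m₀) :
    (w m • Δ m - (c m * w m₀) • Δ m₀) (y m') = if m = m' then w m else 0 := by
  rw [Derivation.sub_apply, Derivation.smul_apply, Derivation.smul_apply, hdual, hdual, smul_eq_mul,
    smul_eq_mul, if_neg (Ne.symm hm'), mul_zero, sub_zero]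
  split_ifs <;> simp

/-- The frame on `y m₀` (`m ≠ m₀`). [folklore] -/
theorem frame_apply_y_self (hdual : ∀ i j, Δ i (y j) = if i = j then 1 else 0) {m : Fin n}
    (hm : m ≠ m₀) :
    (w m • Δ m - (c m * w m₀) • Δ m₀) (y m₀) = -(c m * w m₀) := by
  rw [Derivation.sub_apply, Derivation.smul_apply, Derivation.smul_apply, hdual, hdual, smul_eq_mul,
    smul_eq_mul, if_neg hm, if_pos rfl, mul_zero, mul_one, zero_sub]

/-- **Uniqueness on the foliation.** In a domain with `q ≠ 0` and `c m₀ = 1`: a derivation killing `f`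
and every `y m'`, `m' ≠ m₀`, is zero (it is `θ (y m₀) • Δ m₀`, and `w m₀ * Δ m₀ f = q ≠ 0`). [folklore] -/
theorem eq_zero_of_apply_eq_zero [IsDomain A] (hdual : ∀ i j, Δ i (y j) = if i = j then 1 else 0)
    (hdet : ∀ δ : Derivation ℤ A A, (∀ i, δ (y i) = 0) → δ = 0) (hq : q ≠ 0)
    (hc : ∀ m, (w m • Δ m) f = q * c m) (hm₀ : c m₀ = 1) (θ : Derivation ℤ A A) (hf : θ f = 0)
    (hy : ∀ m', m' ≠ m₀ → θ (y m') = 0) : θ = 0 := by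
  classical
  have hθ : θ = θ (y m₀) • Δ m₀ := by
    conv_lhs => rw [eq_sum_smul y Δ hdual hdet θ]
    rw [Finset.sum_eq_single m₀ (fun m _ hm => by rw [hy m hm, zero_smul])
      (fun h => absurd (Finset.mem_univ _) h)]
  have h0 : w m₀ * Δ m₀ f = q := by
    have := hc m₀
    rwa [Derivation.smul_apply, smul_eq_mul, hm₀, mul_one] at this
  have hΔ : Δ m₀ f ≠ 0 := by
    intro h
    rw [h, mul_zero] at h0
    exact hq h0.symm
  have hy0 : θ (y m₀) = 0 := by
    have := hf
    rw [hθ, Derivation.smul_apply, smul_eq_mul] at this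
    rcases mul_eq_zero.mp this with h | h
    · exact h
    · exact absurd h hΔ
  refine hdet θ fun i => ?_
  rw [hθ, Derivation.smul_apply, hy0, zero_smul]

/-- The frame member `m` kills `w l` for `l ∉ {m, m₀}` (`w l` is `1` or `y l`). [folklore] -/
theorem frame_apply_w_eq_zero (hdual : ∀ i j, Δ i (y j) = if i = j then 1 else 0)
    (hw : ∀ m, w m = 1 ∨ w m = y m) {m l : Fin n} (hml : m ≠ l) (hl : l ≠ m₀) :
    (w m • Δ m - (c m * w m₀) • Δ m₀) (w l) = 0 := by
  rcases hw l with h | h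
  · rw [h]
    exact Derivation.map_one_eq_zero _
  · rw [h, frame_apply_y hdual m hl, if_neg hml]

/-- **The frame commutes.** [folklore] -/
theorem frame_comm [IsDomain A] (hdual : ∀ i j, Δ i (y j) = if i = j then 1 else 0)
    (hdet : ∀ δ : Derivation ℤ A A, (∀ i, δ (y i) = 0) → δ = 0) (hw : ∀ m, w m = 1 ∨ w m = y m)
    (hq : q ≠ 0) (hc : ∀ m, (w m • Δ m) f = q * c m) (hm₀ : c m₀ = 1) (m m' : Fin n) (b : A) :
    (w m • Δ m - (c m * w m₀) • Δ m₀) ((w m' • Δ m' - (c m' * w m₀) • Δ m₀) b) =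
      (w m' • Δ m' - (c m' * w m₀) • Δ m₀) ((w m • Δ m - (c m * w m₀) • Δ m₀) b) := by
  by_cases hmm : m = m'
  · subst hmm; rfl
  have hcomm : ⁅w m • Δ m - (c m * w m₀) • Δ m₀, w m' • Δ m' - (c m' * w m₀) • Δ m₀⁆ = 0 := by
    refine eq_zero_of_apply_eq_zero hdual hdet hq hc hm₀ _ ?_ fun l hl => ?_
    · rw [Derivation.commutator_apply, frame_apply_f hc hm₀, frame_apply_f hc hm₀, map_zero, map_zero,
        sub_zero]
    · rw [Derivation.commutator_apply, frame_apply_y hdual m' hl, frame_apply_y hdual m hl]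
      by_cases h1 : m' = l
      · subst h1
        rw [if_pos rfl, if_neg hmm, map_zero, sub_zero]
        exact frame_apply_w_eq_zero hdual hw hmm hl
      · rw [if_neg h1, map_zero, zero_sub, neg_eq_zero]
        by_cases h2 : m = l
        · subst h2
          rw [if_pos rfl]
          exact frame_apply_w_eq_zero hdual hw (Ne.symm hmm) hl
        · rw [if_neg h2, map_zero]
  have := congrArg (fun D : Derivation ℤ A A => D b) hcomm
  simp only [Derivation.commutator_apply, Derivation.zero_apply, sub_eq_zero] at this
  exact this

/-- **Transversal members are `p`-nilpotent**: if `w m = 1` (`m ∉ J`) then `(ε m)^[p] = 0`.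
[cite: Matsumura1987, §25 (p-th powers of derivations)] -/
theorem iterate_frame_eq_zero [IsDomain A] (p : ℕ) [Fact p.Prime] [CharP A p]
    (hdual : ∀ i j, Δ i (y j) = if i = j then 1 else 0)
    (hdet : ∀ δ : Derivation ℤ A A, (∀ i, δ (y i) = 0) → δ = 0)
    (hq : q ≠ 0) (hc : ∀ m, (w m • Δ m) f = q * c m) (hm₀ : c m₀ = 1) {m : Fin n} (hwm : w m = 1)
    (b : A) : (⇑(w m • Δ m - (c m * w m₀) • Δ m₀))^[p] b = 0 := by
  obtain ⟨r, hr⟩ : ∃ r, p = r + 2 := ⟨p - 2, (Nat.sub_add_cancel (Fact.out : p.Prime).two_le).symm⟩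
  have hD : iteratePrime (w m • Δ m - (c m * w m₀) • Δ m₀) p = 0 := by
    refine eq_zero_of_apply_eq_zero hdual hdet hq hc hm₀ _ ?_ fun l hl => ?_
    · rw [iteratePrime_apply, hr, Function.iterate_succ_apply, frame_apply_f hc hm₀]
      exact Function.iterate_fixed (map_zero _) _
    · rw [iteratePrime_apply, hr, Function.iterate_succ_apply, frame_apply_y hdual m hl,
        Function.iterate_succ_apply]
      have h0 : (w m • Δ m - (c m * w m₀) • Δ m₀) (if m = l then w m else 0) = 0 := by
        split_ifs
        · rw [hwm]; exact Derivation.map_one_eq_zero _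
        · exact map_zero _
      rw [h0]
      exact Function.iterate_fixed (map_zero _) _
  have := congrArg (fun D : Derivation ℤ A A => D b) hD
  simpa only [iteratePrime_apply, Derivation.zero_apply] using this

/-- **Boundary members satisfy `ε^[p] = ε`**: if `w m = y m` (`m ∈ J`) and `m ≠ m₀` then `(ε m)^[p] = ε m`
(the value on `y m` is `y m`, reproduced by every iterate). [cite: Matsumura1987, §25 (p-th powers of derivations)] -/
theorem iterate_frame_eq_self [IsDomain A] (p : ℕ) [Fact p.Prime] [CharP A p]
    (hdual : ∀ i j, Δ i (y j) = if i = j then 1 else 0)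
    (hdet : ∀ δ : Derivation ℤ A A, (∀ i, δ (y i) = 0) → δ = 0)
    (hq : q ≠ 0) (hc : ∀ m, (w m • Δ m) f = q * c m) (hm₀ : c m₀ = 1) {m : Fin n} (hwm : w m = y m)
    (hm : m ≠ m₀) (b : A) :
    (⇑(w m • Δ m - (c m * w m₀) • Δ m₀))^[p] b = (w m • Δ m - (c m * w m₀) • Δ m₀) b := by
  obtain ⟨r, hr⟩ : ∃ r, p = r + 1 := ⟨p - 1, (Nat.sub_add_cancel (Fact.out : p.Prime).one_le).symm⟩
  have hfix : ∀ k : ℕ, (⇑(w m • Δ m - (c m * w m₀) • Δ m₀))^[k] (y m) = y m := by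
    intro k
    refine Function.iterate_fixed ?_ k
    rw [frame_apply_y hdual m hm, if_pos rfl, hwm]
  have hD : iteratePrime (w m • Δ m - (c m * w m₀) • Δ m₀) p - (w m • Δ m - (c m * w m₀) • Δ m₀) = 0 := by
    refine eq_zero_of_apply_eq_zero hdual hdet hq hc hm₀ _ ?_ fun l hl => ?_
    · rw [Derivation.sub_apply, iteratePrime_apply, hr, Function.iterate_succ_apply, frame_apply_f hc hm₀,
        sub_zero]
      exact Function.iterate_fixed (map_zero _) _
    · rw [Derivation.sub_apply, iteratePrime_apply, sub_eq_zero]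
      by_cases hml : m = l
      · subst hml
        rw [hfix, frame_apply_y hdual m hl, if_pos rfl, hwm]
      · rw [hr, Function.iterate_succ_apply, frame_apply_y hdual m hl, if_neg hml]
        exact Function.iterate_fixed (map_zero _) _
  have := congrArg (fun D : Derivation ℤ A A => D b) hD
  simpa only [Derivation.sub_apply, iteratePrime_apply, Derivation.zero_apply, sub_eq_zero] using this

/-- A derivation whose values on generators of `𝔪` lie in `𝔪` maps `𝔪` into `𝔪`. [folklore] -/
theorem apply_mem_maximalIdeal_of_span [IsLocalRing A] (hy : Ideal.span (Set.range y) = maximalIdeal A)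
    (θ : Derivation ℤ A A) (hθ : ∀ i, θ (y i) ∈ maximalIdeal A) {b : A} (hb : b ∈ maximalIdeal A) :
    θ b ∈ maximalIdeal A := by
  rw [← hy] at hb
  induction hb using Submodule.span_induction with
  | mem x hx =>
    obtain ⟨i, rfl⟩ := hx
    exact hθ i
  | zero => rw [map_zero]; exact zero_mem _
  | add x x' _ _ hx hx' => rw [map_add]; exact add_mem hx hx'
  | smul a x hx ihx =>
    rw [smul_eq_mul, Derivation.leibniz, smul_eq_mul, smul_eq_mul]
    refine add_mem (Ideal.mul_mem_left _ _ ihx) (Ideal.mul_mem_right _ _ ?_)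
    have hx' : x ∈ Ideal.span (Set.range y) := hx
    rwa [hy] at hx'

/-- **A boundary member preserves `𝔪`** when `c m * w m₀ ∈ 𝔪` (the normalisation of `exists_logFrame`):
its values on the `y l` are `δ_{ml} y m` (`l ≠ m₀`) and `-(c m * w m₀)` (`l = m₀`). [folklore] -/
theorem frame_mem_maximalIdeal [IsLocalRing A] (hy : Ideal.span (Set.range y) = maximalIdeal A)
    (hdual : ∀ i j, Δ i (y j) = if i = j then 1 else 0) {m : Fin n} (hwm : w m = y m) (hm : m ≠ m₀)
    (hcase : c m * w m₀ ∈ maximalIdeal A) {b : A} (hb : b ∈ maximalIdeal A) :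
    (w m • Δ m - (c m * w m₀) • Δ m₀) b ∈ maximalIdeal A := by
  refine apply_mem_maximalIdeal_of_span hy _ (fun l => ?_) hb
  by_cases hl : l = m₀
  · subst hl
    rw [frame_apply_y_self hdual hm]
    exact neg_mem hcase
  · rw [frame_apply_y hdual m hl]
    split_ifs
    · rw [hwm, ← hy]
      exact Ideal.subset_span ⟨m, rfl⟩
    · exact zero_mem _

end Frame

/-! ## Packaging -/

/-- **The log frame at a simple point, packaged.** `A` a local domain of prime characteristic `p`;
`y : Fin n → A` generating `𝔪` with dual derivations `Δ` determining `Der_ℤ(A)`; `J` the boundary indices and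
`w m = y m` (`m ∈ J`) resp. `1` (`m ∉ J`); a SIMPLE point of `d f` along the boundary: `q ≠ 0` divides `θ f`
for every logarithmic `θ` (`y j ∣ θ (y j)`, `j ∈ J`) and some logarithmic `θ₀` has `θ₀ f = q * unit`. Then there
are an index `m₀`, coefficients `c` with `c m₀ = 1` and `(w m • Δ m) f = q' * c m` for some `q' ≠ 0`, normalised so
that `m₀ ∈ J` or every boundary coefficient lies in `𝔪`, and the FRAME `ε m = w m • Δ m - (c m * w m₀) • Δ m₀`:
killing `f`, diagonal-dual on `y l` (`l ≠ m₀`), commuting, `p`-nilpotent off the boundary, `ε^[p] = ε` and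
`𝔪`-preserving on the boundary (`m ≠ m₀`), with uniqueness «`θ f = 0 ∧ θ (y l) = 0 (l ≠ m₀) ⇒ θ = 0`».
[cite: Matsumura1987, §25, §30] [folklore] -/
theorem exists_logFrame [IsDomain A] [IsLocalRing A] (p : ℕ) [Fact p.Prime] [CharP A p]
    (y : Fin n → A) (hy : Ideal.span (Set.range y) = maximalIdeal A) (Δ : Fin n → Derivation ℤ A A)
    (hdual : ∀ i j, Δ i (y j) = if i = j then 1 else 0)
    (hdet : ∀ δ : Derivation ℤ A A, (∀ i, δ (y i) = 0) → δ = 0) (J : Finset (Fin n)) (w : Fin n → A)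
    (hw : ∀ m, w m = if m ∈ J then y m else 1) {f q : A} (hq : q ≠ 0)
    (hdiv : ∀ θ : Derivation ℤ A A, (∀ j ∈ J, y j ∣ θ (y j)) → q ∣ θ f)
    (θ₀ : Derivation ℤ A A) (hθ₀ : ∀ j ∈ J, y j ∣ θ₀ (y j)) {u : A} (hu : IsUnit u)
    (hθ₀f : θ₀ f = q * u) :
    ∃ (m₀ : Fin n) (c : Fin n → A) (q' : A), q' ≠ 0 ∧ c m₀ = 1 ∧ (∀ m, (w m • Δ m) f = q' * c m) ∧
      (m₀ ∈ J ∨ ∀ j ∈ J, c j ∈ maximalIdeal A) ∧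
      (∀ m, (w m • Δ m - (c m * w m₀) • Δ m₀) f = 0) ∧
      (∀ m l, l ≠ m₀ → (w m • Δ m - (c m * w m₀) • Δ m₀) (y l) = if m = l then w m else 0) ∧
      (∀ m m' b, (w m • Δ m - (c m * w m₀) • Δ m₀) ((w m' • Δ m' - (c m' * w m₀) • Δ m₀) b) =
        (w m' • Δ m' - (c m' * w m₀) • Δ m₀) ((w m • Δ m - (c m * w m₀) • Δ m₀) b)) ∧
      (∀ m, m ∉ J → ∀ b, (⇑(w m • Δ m - (c m * w m₀) • Δ m₀))^[p] b = 0) ∧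
      (∀ m ∈ J, m ≠ m₀ → ∀ b,
        (⇑(w m • Δ m - (c m * w m₀) • Δ m₀))^[p] b = (w m • Δ m - (c m * w m₀) • Δ m₀) b) ∧
      (∀ m ∈ J, m ≠ m₀ → ∀ b ∈ maximalIdeal A, (w m • Δ m - (c m * w m₀) • Δ m₀) b ∈ maximalIdeal A) ∧
      (∀ θ : Derivation ℤ A A, θ f = 0 → (∀ l, l ≠ m₀ → θ (y l) = 0) → θ = 0) := by
  classical
  obtain ⟨c₀, hc₀, m₁, hm₁⟩ := exists_isUnit_logCoeff y Δ hdual hdet J w hw hq hdiv θ₀ hθ₀ hu hθ₀f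
  -- normalisation of the attaining index: prefer a boundary index with a unit coefficient
  have hsel : ∃ m₀, IsUnit (c₀ m₀) ∧ (m₀ ∈ J ∨ ∀ j ∈ J, c₀ j ∈ maximalIdeal A) := by
    by_cases hJ : ∃ j ∈ J, IsUnit (c₀ j)
    · obtain ⟨j, hj, hju⟩ := hJ
      exact ⟨j, hju, Or.inl hj⟩
    · push Not at hJ
      exact ⟨m₁, hm₁, Or.inr fun j hj => (mem_maximalIdeal _).mpr (hJ j hj)⟩
  obtain ⟨m₀, hm₀u, hcase₀⟩ := hsel
  obtain ⟨q', c, hq', hc, hm₀, hcc⟩ := exists_logCoeff_eq_one (E := fun m => w m • Δ m) hq hc₀ hm₀u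
  have hw' : ∀ m, w m = 1 ∨ w m = y m := fun m => by
    rw [hw]; split_ifs <;> simp
  have hcase : m₀ ∈ J ∨ ∀ j ∈ J, c j ∈ maximalIdeal A := by
    rcases hcase₀ with h | h
    · exact Or.inl h
    · exact Or.inr fun j hj => by rw [hcc]; exact Ideal.mul_mem_right _ _ (h j hj)
  have hcase' : ∀ m ∈ J, m ≠ m₀ → c m * w m₀ ∈ maximalIdeal A := by
    intro m hm hmm
    rcases hcase with h | h
    · rw [hw m₀, if_pos h]
      refine Ideal.mul_mem_left _ _ ?_
      rw [← hy]
      exact Ideal.subset_span ⟨m₀, rfl⟩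
    · exact Ideal.mul_mem_right _ _ (h m hm)
  refine ⟨m₀, c, q', hq', hm₀, hc, hcase, fun m => frame_apply_f hc hm₀ m,
    fun m l hl => frame_apply_y hdual m hl,
    fun m m' b => frame_comm hdual hdet hw' hq' hc hm₀ m m' b,
    fun m hm b => iterate_frame_eq_zero p hdual hdet hq' hc hm₀ (by rw [hw, if_neg hm]) b,
    fun m hm hmm b => iterate_frame_eq_self p hdual hdet hq' hc hm₀ (by rw [hw, if_pos hm]) hmm b,
    fun m hm hmm b hb => frame_mem_maximalIdeal hy hdual (by rw [hw, if_pos hm]) hmm (hcase' m hm hmm) hb,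
    fun θ hf hyθ => eq_zero_of_apply_eq_zero hdual hdet hq' hc hm₀ θ hf hyθ⟩


end LogFrame

end Summit.ResolutionOfSingularities.ResolutionOfSingularities.Theorems.SwitchingDichotomy
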